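import Mathlib
import Summits.Ventures.PercRepro2.CutLeafRow
import Summits.Ventures.PercRepro2.CutLeafRowAAB
import Summits.Ventures.PercRepro2.CutLeafRowABA

/-!
# Row (LEAF-½) across a cut vertex separating the roots: the six placements in one statement
(blind cell PercRepro2, p5 g28; `proofs/P5-OEDGE.md` §36 (4))

With `z` a cut vertex, `a₁ ∈ VA`, `a₂ ∈ VB`, and each of `b, o, v` on one of the two sides, there
are eight placements of `(b, o, v)`. Six are kernel theorems — `ABB` (`CutLeafRow.LeafRow_of_cut`),
`AAB` (`CutLeafRowAAB.LeafRow_of_cut_AAB`), `ABA` (`CutLeafRowABA.LeafRow_of_cut_ABA`) and their root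
mirrors `BAA`, `BBA`, `BAB` (read through `CutV.IsCut.symm`) — and the remaining two, `AAA` and `BBB`,
contain every graph (attach `a₂`, resp. `a₁`, as a pendant of probability one), so no cut-vertex
argument applies to them. **`LeafRow_of_cut_sep`** states the six at once: the row holds whenever
the three marks are not all on the same side. Nothing is claimed about `AAA` / `BBB`.
-/

namespace Summit.Ventures.PercRepro2

open UnionCluster CovForm PendantRoot LeafStep LeafHalfCross CutLeafRow

namespace CutLeafRowSix

variable {V : Type*} {E : Type*} [Fintype E] [DecidableEq E] [Fintype V] [DecidableEq V]
  {R : Type*} [Field R] [LinearOrder R] [IsStrictOrderedRing R]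

variable (p : E → R) (ends : E → Sym2 V) {z : V} {VA VB : Set V} {EA EB : Set E}
  [DecidablePred (· ∈ EA)] [DecidablePred (· ∈ EB)]

/-- **Row (LEAF-½) across a cut vertex separating the roots, in every placement of `(b, o, v)` except
«all three with `a₁`» and «all three with `a₂`».** -/
theorem LeafRow_of_cut_sep (hp : IsProbVec p) (h : CutV.IsCut ends z VA VB EA EB)
    {a₁ a₂ b o v : V} (ha₁ : a₁ ∈ VA) (ha₂ : a₂ ∈ VB) (hb : b ∈ VA ∨ b ∈ VB)
    (ho : o ∈ VA ∨ o ∈ VB) (hv : v ∈ VA ∨ v ∈ VB) (hA : ¬ (b ∈ VA ∧ o ∈ VA ∧ v ∈ VA))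
    (hB : ¬ (b ∈ VB ∧ o ∈ VB ∧ v ∈ VB)) : LeafRow p ends o a₁ a₂ v b := by
  rcases hb with hb | hb <;> rcases ho with ho | ho <;> rcases hv with hv | hv
  · exact absurd ⟨hb, ho, hv⟩ hA
  · exact CutLeafRowAAB.LeafRow_of_cut_AAB p ends hp h ha₁ hb ho ha₂ hv
  · exact CutLeafRowABA.LeafRow_of_cut_ABA p ends hp h ha₁ hb hv ha₂ ho
  · exact LeafRow_of_cut p ends EB hp h ha₁ hb ha₂ ho hv
  · exact LeafRow_of_cut' p ends hp h.symm ha₂ hb ha₁ ho hv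
  · exact CutLeafRowABA.LeafRow_of_cut_ABA' p ends hp h.symm ha₂ hb hv ha₁ ho
  · exact CutLeafRowAAB.LeafRow_of_cut_AAB' p ends hp h.symm ha₂ hb ho ha₁ hv
  · exact absurd ⟨hb, ho, hv⟩ hB

end CutLeafRowSix

end Summit.Ventures.PercRepro2
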